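import Summits.CriticalPhenomena.PercolationContinuityZ3.Theorems.FK.Transplant.KNFreeRegressionQOne
import Summits.CriticalPhenomena.PercolationContinuityZ3.Theorems.FK.Transplant.FreeBoundaryHypothesesKN
import Summits.CriticalPhenomena.PercolationContinuityZ3.Theorems.PercNearOneGluingNoHeavyQuantEffectiveTargetLemma
import HarnessLib

/-!
# G-T2, part 2: the `q = 1` regression of the five PROVE binders and of the record theorem (FT-09)

**CONDITIONAL sub-cell context: `FH` (and, since lead ruling L7, `KNFreeTargetHittable` = TP_FK) are OPEN at
the same `p` for `q > 1` (⇔ GRC Conj. (5.103) via K1; barrier note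
`Literature.Barriers.CriticalPhenomena.SamePFreeBoundaryCriteria`, decl `samePFreeBoundaryCriteria`);
the transplant is a typed reduction, not a proof of FK
continuity.** This file is the binder half of the referee gate G-T2 (checklist C5): instantiated at `q = 1`, EVERY
PROVE binder of the record theorem `ufsc0_of_freeBoundaryHypothesis_r0` (v2 names of
`Transplant/FreeBoundaryHypothesesKN.lean`) is an unconditional tree theorem; the record's conclusion at `q = 1`
(`ufsc0_one_of_theta_pos`) is the 10-line composition in `Transplant/KNFreeRegressionQOneRecord.lean` (which imports
the record file). CONE RECORD (fk-ref R-g13-1; referee cone run g13 and the writer's re-run, 2026-08-21): of the six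
`q = 1` regressions exactly ONE runs THROUGH p205010's additive-gluing kernel — `knFreeTargetHittable_one`, the `q = 1`
instance of the OPEN binder TP_FK (KN Lemma 10), obtained from `Quant.targetProperty_of_theta_pos`, i.e. from the PROVED
additive gluing inequality `CSH.additiveGluing_holds` (234 `Theorems.CSH.*` constants in its cone); `fh_one_of_theta_pos`
(part 1), `knFreeElongatedHittable_one`, `knFreeCorridorRestr_one`, `knFreeOriginLook_one` and `knFreeBadRestr_one` carry
0 `CSH.*` constants; the headline declarations `CSH.percolationContinuityZ3_holds` / `CSH.kozmaNitzan_conjecture3_holds` and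
the conditional Prop `KozmaNitzan2024_conjecture3` are in NO cone. Nothing is assumed under another name (every statement
here is an unconditional tree theorem, standard axioms), but the `q = 1` regression of TP_FK IS p205010's content and is
not a gluing-free template for `q > 1`. Builds on p205010 (kernel theorem, internal audit signed; external expert review pending).
Writer+proposer fkp-01-g2 (delegated by fkt-lead, INBOX 2026-08-21T01:16Z; spec `FT09-SPEC.md`); by design the
ONLY transplant files with `prodBernoulli` in their cone are the three `KNFreeRegressionQOne*` files (FT-08 (iv), checklist D1).

## How (everything is transport through part 1's `fkLaw Λ W 1 = prodBernoulli W` under `FinSupp W Λ`)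

4. Transport of the matrices: `fkTargetAt_one_iff` (the FK target matrix at `q = 1` ↔ the tree's
   `TargetProperty` matrix), `fkCorridorRestrAt_one_iff` (the RESTRICTED corridor matrix with plain `openConn`
   ↔ the tree's `openConnIn` matrix: `fkLaw_restrW_one_real_biUnion_openConn`, i.e. tree
   `prodBernoulli_restrW_real_biUnion_openConn` — under `restrW A W` the pairs off `A` are a.s. closed).
5. The examination vocabulary: `condFK_one_iff`, `badFK_one_eq : badFK S 1 h e du = S.bad h e du`,
   `validFK_one_iff : ValidFK S 1 h e ↔ S.Valid h e`, `originFK_one_iff` (locality of the origin weighting,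
   fk-ref R-g8-1: `prodBernoulli_restrW_real_eq_of_determinedBy` + `determinedBy_biUnion_openConnIn`), the three
   laws `fkLaw_Wt_one`, `fkLaw_Wfull_one`, `fkLaw_W₀_one` (all KN weightings are `restrW` of their region).
6. The binders: R2 `knFreeTargetHittable_one` (tree `Quant.targetProperty_of_theta_pos`, needs `0 < p`) and its
   converse `targetProperty_of_knFreeTargetHittable_one`; R3 `knFreeElongatedHittable_one` (tree
   `isHittable_of_mem_elongList_of_target`); R4 `knFreeCorridorRestr_one` (tree `CData.corridorLemma_of_target`);
   R5 `knFreeOriginLook_one` (tree `KSch.hQ0_of_hit`, every `p`); R6 `knFreeBadRestr_one` (tree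
   `KSch.real_bad_le`, every `p`).
7. (in `KNFreeRegressionQOneRecord.lean`) `ufsc0_one_of_theta_pos`, `ufsc0_three_one_of_theta_pos`.

No binder needed an extra hypothesis at `q = 1` (FT09-SPEC, last paragraph: no finding against any v2 binder).
[cite: KozmaNitzan2024, §4 Lemmas 9–12, Theorem 6 (pp. 16–31)] [cite: Grimmett2006, §1.2–1.3 (q = 1), eq. (1.20)]
-/

noncomputable section

open scoped Classical

namespace Summit.CriticalPhenomena.PercolationContinuityZ3.Theorems.FK

open MeasureTheory Literature.Probability.Percolation Literature.Probability.LatticeModels SimpleGraph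
open Literature.Probability.Percolation.GadgetSystem Literature.Probability.Percolation.KozmaNitzan

variable {d : ℕ}

/-! ### 4. Transport of the KN matrices at `q = 1` -/

section Transport

/-- Restriction preserves finite support. [folklore] -/
theorem finSupp_restrW_set {W : Sym2 (Site d) → unitInterval} {Sfin : Finset (Site d)} (hW : FinSupp W Sfin)
    (A : Set (Site d)) : FinSupp (restrW A W) Sfin := by
  refine ⟨fun e he => ?_⟩
  by_cases heA : e ∈ wireSet A
  · rw [restrW_apply_of_mem _ heA, hW.zero e he]
  · rw [restrW_apply_of_not_mem _ heA]

/-- `P_{restrW A W}(o ↔ T) = P_W(o ↔ T inside A)` for a `Finset`-indexed target (tree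
`prodBernoulli_restrW_real_biUnion_openConn`). [cite: KozmaNitzan2024, §4 p. 24 (P(o ↔^A ·))] -/
theorem prodBernoulli_restrW_real_biUnion_openConn_finset (W : Sym2 (Site d) → unitInterval)
    (A : Set (Site d)) {o : Site d} (ho : o ∈ A) (T : Finset (Site d)) :
    (prodBernoulli (restrW A W)).real (⋃ t ∈ T, openConn o t) =
      (prodBernoulli W).real (⋃ t ∈ T, openConnIn A o t) :=
  prodBernoulli_restrW_real_biUnion_openConn W A ho (↑T : Set (Site d))

/-- **The restricted-law / plain-`openConn` matrix at `q = 1` is KN's `openConnIn` matrix**: for a weighting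
`W` finitely supported in `Sfin` and `o ∈ A`,
`(fkLaw Sfin (restrW A W) 1)(o ↔ T) = P_W(o ↔ T inside A)`. [cite: KozmaNitzan2024, §4 p. 24] -/
theorem fkLaw_restrW_one_real_biUnion_openConn {W : Sym2 (Site d) → unitInterval} {Sfin : Finset (Site d)}
    (hW : FinSupp W Sfin) (A : Set (Site d)) {o : Site d} (ho : o ∈ A) (T : Finset (Site d)) :
    (fkLaw Sfin (restrW A W) 1).real (⋃ t ∈ T, openConn o t) =
      (prodBernoulli W).real (⋃ t ∈ T, openConnIn A o t) := by
  rw [fkLaw_one_of_finSupp (finSupp_restrW_set hW A)]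
  exact prodBernoulli_restrW_real_biUnion_openConn_finset W A ho T

/-- **The FK target matrix at `q = 1` is the tree's `TargetProperty` matrix** (`fkLaw Sfin W 1 = prodBernoulli W`
under the standing hypothesis `FinSupp W Sfin`). [cite: KozmaNitzan2024, §4 Lemma 10 (pp. 17–22)] -/
theorem fkTargetAt_one_iff (p : unitInterval) (δ ε : ℝ) (H : List (Geom d)) (R : ℕ) :
    FKTargetAt d 1 p δ ε H R ↔
      ∀ (W : Sym2 (Site d) → unitInterval) (Sfin D : Finset (Site d)) (lo hi : Site d)
        (T : Finset (Site d)) (o : Site d),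
        FinSupp W Sfin → IsSubbox W p D → D ⊆ Sfin → o ∈ Sfin → o ∉ D →
        Finset.Icc (lo - (R : Site d)) (hi + (R : Site d)) ⊆ D →
        IsTarget T lo hi D R H → T ⊆ D → T.Nonempty →
        1 - δ < (prodBernoulli W).real (⋃ b ∈ Finset.Icc lo hi, openConn o b) →
          1 - ε < (prodBernoulli W).real (⋃ t ∈ T, openConn o t) := by
  constructor
  · intro h W Sfin D lo hi T o hfin hsub hDS ho hoD hIcc htgt hTD hTne hB
    have h' := h W Sfin D lo hi T o hfin hsub hDS ho hoD hIcc htgt hTD hTne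
    rw [fkLaw_one_of_finSupp hfin] at h'
    exact h' hB
  · intro h W Sfin D lo hi T o hfin hsub hDS ho hoD hIcc htgt hTD hTne hB
    rw [fkLaw_one_of_finSupp hfin] at hB ⊢
    exact h W Sfin D lo hi T o hfin hsub hDS ho hoD hIcc htgt hTD hTne hB

/-- **The restricted FK corridor matrix at `q = 1` is the tree's corridor matrix** (both events read
"inside `A`" / "inside `U`" under `P_{T.W}`; `T.o ∈ A ⊆ U`). [cite: KozmaNitzan2024, §4 Lemma 12 (pp. 23–25)] -/
theorem fkCorridorRestrAt_one_iff (p : unitInterval) (δ ε : ℝ) (m : ℕ) :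
    FKCorridorRestrAt d 1 p δ ε m ↔
      ∀ T : CData d, T.Hyp p → m ≤ T.r →
        1 - δ < (prodBernoulli T.W).real
            (⋃ b ∈ Finset.Icc (T.c - ((3 * T.r : ℕ) : Site d)) (T.c + ((3 * T.r : ℕ) : Site d)),
              openConnIn (↑T.Aset : Set (Site d)) T.o b) →
          1 - ε < (prodBernoulli T.W).real (⋃ b ∈ T.Tn (3 * T.r), openConnIn (↑T.Uset : Set (Site d)) T.o b) := by
  have key : ∀ T : CData d, T.Hyp p →
      ((fkLaw T.Sfin (restrW (↑T.Aset : Set (Site d)) T.W) 1).real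
          (⋃ b ∈ Finset.Icc (T.c - ((3 * T.r : ℕ) : Site d)) (T.c + ((3 * T.r : ℕ) : Site d)), openConn T.o b) =
        (prodBernoulli T.W).real
          (⋃ b ∈ Finset.Icc (T.c - ((3 * T.r : ℕ) : Site d)) (T.c + ((3 * T.r : ℕ) : Site d)),
            openConnIn (↑T.Aset : Set (Site d)) T.o b)) ∧
      ((fkLaw T.Sfin (restrW (↑T.Uset : Set (Site d)) T.W) 1).real (⋃ b ∈ T.Tn (3 * T.r), openConn T.o b) =
        (prodBernoulli T.W).real (⋃ b ∈ T.Tn (3 * T.r), openConnIn (↑T.Uset : Set (Site d)) T.o b)) := by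
    intro T hT
    have hoA : T.o ∈ (↑T.Aset : Set (Site d)) := Finset.mem_coe.2 (T.o_mem_Aset hT)
    have hoU : T.o ∈ (↑T.Uset : Set (Site d)) := Finset.mem_coe.2 (T.Aset_subset_Uset (T.o_mem_Aset hT))
    exact ⟨fkLaw_restrW_one_real_biUnion_openConn hT.fin _ hoA _,
      fkLaw_restrW_one_real_biUnion_openConn hT.fin _ hoU _⟩
  constructor
  · intro h T hT hmr hyp
    obtain ⟨e₁, e₂⟩ := key T hT
    have h' := h T hT hmr
    rw [e₁, e₂] at h'
    exact h' hyp
  · intro h T hT hmr hyp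
    obtain ⟨e₁, e₂⟩ := key T hT
    rw [e₁] at hyp
    rw [e₂]
    exact h T hT hmr hyp

end Transport

/-! ### 5. The examination vocabulary at `q = 1` is the tree's (`condFK`, `badFK`, `ValidFK`, `OriginFK`) -/

section SchemeAtOne

variable (S : KSch d)

/-- The law of (30)-FK at `q = 1` is KN's pinned-restricted product law `prodBernoulli (Wt)`.
[cite: KozmaNitzan2024, §4 p. 27 ((30))] -/
theorem fkLaw_Wt_one (h : ProbeHistory (Site d)) (e : Site 2 × MDir) (du : MDir) (j : ℕ)
    (o : Finset (Sym2 (Site d))) :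
    fkLaw (S.Sx h e du) (S.Wt h e du j o) 1 = prodBernoulli (S.Wt h e du j o) :=
  fkLaw_one_of_finSupp (finSupp_restrW (S.Sx h e du) _)

/-- The minimal law `P^x` at `q = 1` is `prodBernoulli (Wfull)`. [cite: KozmaNitzan2024, §4 p. 28 (Ω)] -/
theorem fkLaw_Wfull_one (h : ProbeHistory (Site d)) (e : Site 2 × MDir) (du : MDir) :
    fkLaw (S.Sx h e du) (S.Wfull h e du) 1 = prodBernoulli (S.Wfull h e du) :=
  fkLaw_one_of_finSupp (finSupp_restrW (S.Sx h e du) _)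

/-- The law of (32) at `q = 1` is `prodBernoulli (W₀)`. [cite: KozmaNitzan2024, §4 p. 28 ((32))] -/
theorem fkLaw_W₀_one (h : ProbeHistory (Site d)) (e : Site 2 × MDir) :
    fkLaw (S.V h ∪ S.C.Ewv e.1 e.2) (S.W₀ h e) 1 = prodBernoulli (S.W₀ h e) :=
  fkLaw_one_of_finSupp (finSupp_restrW (S.V h ∪ S.C.Ewv e.1 e.2) _)

/-- (30)-FK at `q = 1` is the tree's (30). [cite: KozmaNitzan2024, §4 p. 27 ((30))] -/
theorem condFK_one_iff (h : ProbeHistory (Site d)) (e : Site 2 × MDir) (du : MDir) (j : ℕ)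
    (o : Finset (Sym2 (Site d))) : condFK S 1 h e du j o ↔ S.cond h e du j o := by
  unfold condFK KSch.cond
  rw [fkLaw_Wt_one]

/-- The FK bad event at `q = 1` is the tree's bad event. [cite: KozmaNitzan2024, §4 p. 27 (j_x), p. 31] -/
theorem badFK_one_eq (h : ProbeHistory (Site d)) (e : Site 2 × MDir) (du : MDir) :
    badFK S 1 h e du = S.bad h e du := by
  ext ω
  simp only [badFK, KSch.bad, Set.mem_setOf_eq, condFK_one_iff]

/-- FK-valid histories at `q = 1` are the tree's valid histories. [cite: KozmaNitzan2024, §4 pp. 26–28 ((29), (31), (32))] -/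
theorem validFK_one_iff (h : ProbeHistory (Site d)) (e : Site 2 × MDir) : ValidFK S 1 h e ↔ S.Valid h e := by
  constructor
  · rintro ⟨h1, h2, h3, h4, h5, h6⟩
    rw [fkLaw_W₀_one] at h6
    exact ⟨h1, h2, h3, h4, h5, h6⟩
  · rintro ⟨h1, h2, h3, h4, h5, h6⟩
    refine ⟨h1, h2, h3, h4, h5, ?_⟩
    rw [fkLaw_W₀_one]
    exact h6

/-- (32)-FK at the origin at `q = 1` is the conclusion of the tree's `KSch.hQ0_of_hit` (the event
`{0 ↔ M_v inside Q_0 ∪ E_{0,v}}` is determined by the pairs inside the region, where the origin weighting is the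
whole-lattice pinned weighting — locality, fk-ref R-g8-1). [cite: KozmaNitzan2024, §4 p. 28 ((32) for w = 0)] -/
theorem originFK_one_iff (du : MDir) :
    OriginFK S 1 du ↔
      1 - S.δc < (prodBernoulli (pinW (lattW d S.p) ↑S.U₀ ↑S.U₀)).real
        (⋃ t ∈ (↑(S.C.M ((0 : Site 2) + stepVec du)) : Set (Site d)),
          openConnIn (↑(S.C.Q 0 ∪ S.C.Ewv 0 du) : Set (Site d)) 0 t) := by
  unfold OriginFK
  rw [fkLaw_restrW_one, prodBernoulli_restrW_real_eq_of_determinedBy _ _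
    (determinedBy_biUnion_openConnIn _ _ _ subset_rfl) (measurableSet_biUnion_openConnIn _ _ _)]

end SchemeAtOne

/-! ### 6. The five PROVE binders at `q = 1` -/

section Binders

/-- **R2 — the FK target property at `q = 1`** is the tree's Kozma–Nitzan target property, a theorem for
`θ(p) > 0`, `0 < p < 1` (tree `Quant.targetProperty_of_theta_pos`): hittability and the matrix are transported
by `isHittableFK_one_iff` and `fkTargetAt_one_iff`. Cone: THROUGH p205010's additive gluing (`CSH.additiveGluing_holds`,
via `Quant.targetProperty_of_theta_pos`; fk-ref R-g13-1). [cite: KozmaNitzan2024, §4 Lemma 10 (pp. 17–22)] -/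
theorem knFreeTargetHittable_one [NeZero d] (p : unitInterval) (hp0 : 0 < (p : ℝ)) (hp1 : (p : ℝ) < 1)
    (hθ : 0 < theta (zdGraph d) 0 p) : KNFreeTargetHittable d 1 p := by
  have hT : TargetProperty d p := Quant.targetProperty_of_theta_pos p hp0 hp1 hθ
  intro ε hε
  obtain ⟨δ, hδ, hH⟩ := hT hε
  refine ⟨δ, hδ, fun H hHfk => ?_⟩
  obtain ⟨R, hR⟩ := hH H fun g hg => isHittable_of_isHittableFK_one (hHfk g hg)
  exact ⟨R, (fkTargetAt_one_iff p δ ε H R).2 hR⟩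

/-- Conversely, the FK target property at `q = 1` gives back the tree's target property.
[cite: KozmaNitzan2024, §4 Lemma 10 (pp. 17–22)] -/
theorem targetProperty_of_knFreeTargetHittable_one {p : unitInterval} (h : KNFreeTargetHittable d 1 p) :
    TargetProperty d p := by
  intro ε hε
  obtain ⟨δ, hδ, hH⟩ := h hε
  refine ⟨δ, hδ, fun H hH' => ?_⟩
  obtain ⟨R, hR⟩ := hH H fun g hg => isHittableFK_one_of_isHittable (hH' g hg)
  exact ⟨R, (fkTargetAt_one_iff p δ ε H R).1 hR⟩

/-- **R3 — KN Lemma 11 at `q = 1`** (tree `isHittable_of_mem_elongList_of_target`, through `isHittableFK_one_iff`).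
[cite: KozmaNitzan2024, §4 Lemma 11 (p. 22)] -/
theorem knFreeElongatedHittable_one [NeZero d] (p : unitInterval) (hp1 : (p : ℝ) < 1)
    (hθ : 0 < theta (zdGraph d) 0 p) : KNFreeElongatedHittable d 1 p := by
  intro hT _ K hK g hg
  exact isHittableFK_one_of_isHittable (isHittable_of_mem_elongList_of_target p
    (targetProperty_of_knFreeTargetHittable_one hT) hp1 hθ K hK g hg)

/-- **R4 — KN Lemma 12 at `q = 1`** (tree `CData.corridorLemma_of_target`, through `fkCorridorRestrAt_one_iff`).
[cite: KozmaNitzan2024, §4 Lemma 12 (pp. 23–25)] -/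
theorem knFreeCorridorRestr_one [NeZero d] (p : unitInterval) (hp1 : (p : ℝ) < 1)
    (hθ : 0 < theta (zdGraph d) 0 p) : KNFreeCorridorRestr d 1 p := by
  intro hT _ ε hε
  obtain ⟨δ, hδ, m, hm⟩ :=
    CData.corridorLemma_of_target p (targetProperty_of_knFreeTargetHittable_one hT) hp1 hθ hε
  exact ⟨δ, hδ, m, (fkCorridorRestrAt_one_iff p δ ε m).2 hm⟩

/-- **R5 — (32) at the origin from one free look, at `q = 1`**: the free look at `q = 1` has exactly the
`P_p`-probability of KN's link event (`fkLaw_hitW_one_real_linkIn`), which is the hypothesis of the tree's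
`KSch.hQ0_of_hit`; its conclusion is `OriginFK S 1 du` by `originFK_one_iff` (locality of the origin weighting).
[cite: KozmaNitzan2024, §4 p. 28 ((32) for w = 0)] -/
theorem knFreeOriginLook_one (p : unitInterval) : KNFreeOriginLook d 1 p := by
  intro S _ du hlook
  have hhit := hlook
  unfold FKLookAt at hhit
  rw [fkLaw_hitW_one_real_linkIn, GM.ball_zero] at hhit
  exact (originFK_one_iff S du).2 (S.hQ0_of_hit du hhit)

/-- **R6 — (36)–(37) for one direction at `q = 1`** is the tree's `KSch.real_bad_le`: the restricted corridor
matrix and the target matrix are transported by `fkCorridorRestrAt_one_iff` / `fkTargetAt_one_iff`, valid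
histories and the bad event by `validFK_one_iff` / `badFK_one_eq`, the minimal law by `fkLaw_Wfull_one`.
[cite: KozmaNitzan2024, §4 pp. 28–31 ((33), (36), (37))] -/
theorem knFreeBadRestr_one (p : unitInterval) : KNFreeBadRestr d 1 p := by
  intro S _ ε' δ₂ hδ₂ R hcorr htgt hRs h e du hV hdu
  have hV' : S.Valid h e := (validFK_one_iff S h e).1 hV
  have hcorr' := (fkCorridorRestrAt_one_iff S.p S.δc ε' S.C.r).1 hcorr
  have htgt' := (fkTargetAt_one_iff S.p δ₂ S.δc _ R).1 htgt
  rw [fkLaw_Wfull_one, badFK_one_eq]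
  exact KSch.real_bad_le hV' hdu hδ₂ (fun T hT hr => hcorr' T hT hr.ge) htgt' hRs

end Binders

end Summit.CriticalPhenomena.PercolationContinuityZ3.Theorems.FK

end
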